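import Summits.ResolutionOfSingularities.ResolutionOfSingularities.Theorems.EquisingularLiftEquisingularLiftNatTowerRoundTwoDefs
import Summits.ResolutionOfSingularities.ResolutionOfSingularities.Theorems.EquisingularLiftEquisingularLiftNatLiftableNoseClass2ThenPoints
import Summits.ResolutionOfSingularities.ResolutionOfSingularities.Theorems.EquisingularLiftEquisingularLiftNatSubchainPointResolutionOff
import Summits.ResolutionOfSingularities.ResolutionOfSingularities.Theorems.EquisingularLiftEquisingularLiftNatModelStepChain
import HarnessLib

/-!
# Route `EquisingularLift`, crux EL♮(3) (stmt-ResolutionOfSingularities-20148) / EL♮ (stmt-…-20038) — rung NOSE-TOWER₃: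
# the registered stub `stub_elnat_ratNoseTowerResolution` MODULO its sub-chain supplier HSUB′(ReachNoseTower₃)

[OURS · L1 W4.5(b)] res-D-pv-018 g5 (custody res-plan-2 IDLE POOL DEAL #67 (1) 2026-08-27T19:57:11Z, res-L1-w45b-plan-1 NO OBJECTION
19:57:20Z; object T-NOSE-INST₃ of res-L1-w45b-plan-1 / res-L1-w45b-lead-2 DELTA 19:56:29Z). Helper file `--supports stmt-ResolutionOfSingularities-20148
--as helper`. HONEST FRAMING: OURS (cell res-hironaka, slot W4.5(b)); planning/assembly vocabulary of the crux chain, NOT a statement of any manuscript;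
AI-written, weaker than expert review. No `sorry`; standard axioms.

WHAT. `stub_elnat_ratNoseTowerResolution_of_subchainLift₃ (p) (hsub : HSUB′(ReachNoseTower₃)) : <TARGET-RATNOSETOWER3.sig.txt 3a52d702128a1d15>` —
the TOWER TWIN of res-type-051's `horizBody_of_noseThenPoints` (…NatNoseThenPointsHoriz, p516996) composed as res-L1-w45b-lead-2 g1's
`elnat_noseThenPoints_of_liftableCentre` (…NatNoseThenPointsOfLiftableCentre): Witt/Cohen ring `stub_wittRing` ↦ the fixed ambient `ℙⁿ_O` with
res-D-pv-029's K5′ frame VERBATIM (…NatSubchainPointResolutionOff p523491: base model square `g : ℙⁿ_k → ℙⁿ_O`, the horizontal-E1 stage predicate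
`Ch` with its closure property and `Ch ⇒ Split.Chain`) ↦ the LIFT of the nose class `lift_of_isLiftableNoseClass₂` (res-type-051, p538681: an
`O`-smooth centre `C ⊂ ℙⁿ_O` with exact trace `C · 𝒪_{ℙⁿ_k} = 𝓘⟨Z⟩` along every graded `φ` over `π`) ↦ the NOSE STEP in chain currency by
res-D-pv-029's `modelStep_chain` (…NatModelStepChain: the blow-up `τ₁ : X₁ → ℙⁿ_O` of `C` with its `Ch`-stage, the model square `j₂ : F₂ → X₁` of the
given downstairs blow-up `υ : F₂ → ℙⁿ_k` of `𝓘⟨Z⟩`, `j₂ ≫ τ₁ = υ ≫ g`) ↦ ONE call of the supplier `hsub` = HSUB′(ReachNoseTower₃) (res-D-pv-035's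
binder list `D/res-D-pv-035/nose/HSUB-RATNOSETOWER3.sig.txt` cad6759341cbb034 VERBATIM; its assembler `hsub_reachNoseTower₃_of_invariant` is
…NatNoseTowerDriverThree) on the tower datum of `ReachNoseTower₃` (…NatTowerRoundTwoDefs p562650: `ℙⁿ_k ↦ F₁`, `range ι ↦ T₁`) ↦ K5′'s END transport
VERBATIM (regularity of the reduced strict transform through the model square, `isRegular_subscheme_vanishingIdeal_image_iff`).
So `stub_elnat_ratNoseTowerResolution p := stub_elnat_ratNoseTowerResolution_of_subchainLift₃ p (the supplier)` once the NOSETOWER₃ assembler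
(res-D-pv-035) delivers HSUB′.

References (OURS, index only): p523491 (K5′), p564140 (lead-2's TOWER₃-INST closer pattern), p538681, p516996, p518249 (`ciNose_horizSupplier`, the
piece HSUB′ replaces), p562650, …NatNoseTowerDriverThree.
-/

set_option linter.dupNamespace false -- mandated namespace `Summit.<Summit>.<Problem>` of this single-conjunct summit
set_option linter.overlappingInstances false -- signatures carry `[IsDomain O] [IsDiscreteValuationRing O]`

noncomputable section

open CategoryTheory CategoryTheory.Limits AlgebraicGeometry TopologicalSpace Topology
open MvPolynomial
open Literature.AlgebraicGeometry.Resolution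
open AlgebraicGeometry.Scheme.IdealSheafData
open Summit.ResolutionOfSingularities.ResolutionOfSingularities.Theses.EquisingularLift.Split
open Summit.ResolutionOfSingularities.ResolutionOfSingularities.Cruxes.EquisingularLift.StrataSplit

namespace Summit.ResolutionOfSingularities.ResolutionOfSingularities.Cruxes.EquisingularLiftNat.Sections

/-- **NOSE-TOWER₃-INST: the registered stub `stub_elnat_ratNoseTowerResolution` (TARGET-RATNOSETOWER3.sig.txt 3a52d702128a1d15) MODULO its
sub-chain supplier HSUB′(ReachNoseTower₃)** (res-D-pv-035's binder list cad6759341cbb034, hypothesis `hsub` verbatim): Witt ring + `ℙⁿ_O` + K5′'s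
frame + `lift_of_isLiftableNoseClass₂` + `modelStep_chain` at the lifted nose + ONE call of `hsub` on the tower datum of `ReachNoseTower₃` + K5′'s
END transport. [folklore; pure assembly of p523491 / p538681 / …NatModelStepChain over the registered texts] [OURS · L1 W4.5b] -/
theorem stub_elnat_ratNoseTowerResolution_of_subchainLift₃ (p : ℕ)
    (hsub : ∀ (k : Type) [Field k] (n : ℕ),
    ∀ (O : Type) [CommRing O] [IsDomain O] [IsDiscreteValuationRing O] [IsAdicComplete (IsLocalRing.maximalIdeal O) O] [IsAlgClosed (IsLocalRing.ResidueField O)] (θ : O →+* k), Function.Surjective θ → ∀ (P : AlgebraicGeometry.Scheme.{0}) (q : P ⟶ AlgebraicGeometry.Spec (.of O)) (Y : Set P) (Ch : ∀ X' : AlgebraicGeometry.Scheme.{0}, (X' ⟶ P) → Set X' → Prop), (∀ (X' X'' : AlgebraicGeometry.Scheme.{0}) (σ' : X' ⟶ P) (S' : Set X') (C : X'.IdealSheafData) (τ : X'' ⟶ X'), Ch X' σ' S' → Literature.AlgebraicGeometry.Resolution.IsBlowup τ C → Literature.AlgebraicGeometry.Resolution.Scheme.IsRegular C.subscheme → AlgebraicGeometry.Flat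 (C.subschemeι ≫ σ' ≫ q) → σ' '' (C.support : Set X') ⊆ {y | ¬ IsGenericPoint y Y} → (C.support : Set X') ∩ (σ' ≫ q) ⁻¹' {IsLocalRing.closedPoint O} ⊆ S' → Ch X'' (τ ≫ σ') (closure (τ ⁻¹' (S' \ (C.support : Set X'))))) → (∀ (X' : AlgebraicGeometry.Scheme.{0}) (σ' : X' ⟶ P) (S' : Set X'), Ch X' σ' S' → Summit.ResolutionOfSingularities.ResolutionOfSingularities.Theses.EquisingularLift.Split.Chain P Y X' σ' S') → Y ⊆ q ⁻¹' {IsLocalRing.closedPoint O} → IsIrreducible Y → IsClosed Y → AlgebraicGeometry.IsIntegral P → IsLocallyNoetherian P → Literature.AlgebraicGeometry.Resolution.Scheme.IsRegular P → AlgebraicGeometry.IsProper q → AlgebraicGeometry.SmoothOfRelativeDimension n q → ∀ (X' : AlgebraicGeometry.Scheme.{0}) (σ' : X' ⟶ P) (S' : Set X'), Ch X' σ' S' → AlgebraicGeometry.IsIntegral X' → IsLocallyNoetherian X' → Literature.AlgebraicGeometry.Resolution.Scheme.IsRegular X' → AlgebraicGeometry.IsDominant (σ' ≫ q) → ∀ (F₁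 : AlgebraicGeometry.Scheme.{0}), AlgebraicGeometry.IsIntegral F₁ → ∀ (j : F₁ ⟶ X') (t : F₁ ⟶ AlgebraicGeometry.Spec (.of k)), IsPullback j t (σ' ≫ q) (AlgebraicGeometry.Spec.map (CommRingCat.ofHom θ)) → ∀ (T₁ : Set F₁), IsClosed T₁ → IsIrreducible T₁ → j '' T₁ = S' → ∀ (Z : Set F₁) (hZ : IsClosed Z), Z ⊆ T₁ → ¬ (T₁ ⊆ Z) → Z.Infinite → ∀ (C : X'.IdealSheafData), AlgebraicGeometry.Smooth (C.subschemeι ≫ σ' ≫ q) → Literature.AlgebraicGeometry.Resolution.Scheme.IsRegular C.subscheme → AlgebraicGeometry.Flat (C.subschemeι ≫ σ' ≫ q) → C.comap j = AlgebraicGeometry.Scheme.IdealSheafData.vanishingIdeal (⟨Z, hZ⟩ : TopologicalSpace.Closeds F₁) → (∀ c ∈ (C.support : Set X'), ¬ IsGenericPoint (σ' c) Y) → ∀ (X₁ : AlgebraicGeometry.Scheme.{0}) (τ₁ : X₁ ⟶ X'), Literature.AlgebraicGeometry.Resolution.IsBlowup τ₁ C → AlgebraicGeometry.IsIntegral X₁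 → IsLocallyNoetherian X₁ → Literature.AlgebraicGeometry.Resolution.Scheme.IsRegular X₁ → AlgebraicGeometry.IsDominant ((τ₁ ≫ σ') ≫ q) → ∀ (F₂ : AlgebraicGeometry.Scheme.{0}), AlgebraicGeometry.IsIntegral F₂ → ∀ (υ : F₂ ⟶ F₁), Literature.AlgebraicGeometry.Resolution.IsBlowup υ (AlgebraicGeometry.Scheme.IdealSheafData.vanishingIdeal (⟨Z, hZ⟩ : TopologicalSpace.Closeds F₁)) → ∀ (j₂ : F₂ ⟶ X₁) (t₂ : F₂ ⟶ AlgebraicGeometry.Spec (.of k)), IsPullback j₂ t₂ ((τ₁ ≫ σ') ≫ q) (AlgebraicGeometry.Spec.map (CommRingCat.ofHom θ)) → j₂ ≫ τ₁ = υ ≫ j → (C.comap τ₁).comap j₂ = (AlgebraicGeometry.Scheme.IdealSheafData.vanishingIdeal (⟨Z, hZ⟩ : TopologicalSpace.Closeds F₁)).comap υ → IsIrreducible (closure (υ ⁻¹' (T₁ \ Z))) → Ch X₁ (τ₁ ≫ σ') (j₂ '' closure (υ ⁻¹' (T₁ \ Z))) →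
      ∀ (F' : AlgebraicGeometry.Scheme.{0}) (γ' : F' ⟶ F₂) (T' E' K' : Set F'), (∀ R₁ : (∀ G : AlgebraicGeometry.Scheme.{0}, (G ⟶ F₂) → Set G → Set G → Set G → Prop), R₁ F₂ (𝟙 F₂) (closure (υ ⁻¹' (T₁ \ Z))) (υ ⁻¹' Z) ∅ → TowerPtReg₂ F₁ F₂ υ R₁ → TowerPtRam₂ F₁ F₂ υ R₁ → TowerRound₂ F₁ F₂ υ Z hZ R₁ → R₁ F' γ' T' E' K') → ∃ (X₉ : AlgebraicGeometry.Scheme.{0}) (σ₉ : X₉ ⟶ P) (S₉ : Set X₉) (j₉ : F' ⟶ X₉) (t₉ : F' ⟶ AlgebraicGeometry.Spec (.of k)), Ch X₉ σ₉ S₉ ∧ AlgebraicGeometry.IsIntegral X₉ ∧ IsLocallyNoetherian X₉ ∧ Literature.AlgebraicGeometry.Resolution.Scheme.IsRegular X₉ ∧ AlgebraicGeometry.IsDominant (σ₉ ≫ q) ∧ IsPullback j₉ t₉ (σ₉ ≫ q) (AlgebraicGeometry.Spec.map (CommRingCat.ofHom θ)) ∧ j₉ '' T' = S₉ ∧ IsClosed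 T' ∧ IsIrreducible T' ∧ AlgebraicGeometry.IsIntegral F') :
    p.Prime → ∀ (k : Type) [Field k] [CharP k p] [IsAlgClosed k] (n : ℕ) (H : AlgebraicGeometry.Scheme.{0}) (ι : H ⟶ (Literature.AlgebraicGeometry.Motives.projectiveSpace n k).left), AlgebraicGeometry.IsClosedImmersion ι → AlgebraicGeometry.IsIntegral H → (∀ y : (Literature.AlgebraicGeometry.Motives.projectiveSpace n k).left, ∃ U : (Literature.AlgebraicGeometry.Motives.projectiveSpace n k).left.affineOpens, y ∈ (U : (Literature.AlgebraicGeometry.Motives.projectiveSpace n k).left.Opens) ∧ (ι.ker.ideal U).IsPrincipal) → (ReachNoseTower₃ k n H ι) → ∃ (O : Type) (_ : CommRing O) (_ : IsDomain O) (_ : IsDiscreteValuationRing O) (_ : CharZero O) (π : O →+* k), Function.Surjective π ∧ (letI := MvPolynomial.gradedAlgebra (σ := Fin (n + 1)) (R := O); letI := MvPolynomial.gradedAlgebra (σ := Fin (n + 1)) (R := k); ∀ (φ : MvPolynomial.homogeneousSubmodule (Fin (n + 1)) O →+*ᵍ MvPolynomial.homogeneousSubmodule (Fin (n + 1)) k)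 (hφ' : HomogeneousIdeal.irrelevant (MvPolynomial.homogeneousSubmodule (Fin (n + 1)) k) ≤ (HomogeneousIdeal.irrelevant (MvPolynomial.homogeneousSubmodule (Fin (n + 1)) O)).map φ), (∀ s, φ s = MvPolynomial.map π s) → ∀ Y : Set (AlgebraicGeometry.Proj (MvPolynomial.homogeneousSubmodule (Fin (n + 1)) O)), Y = Set.range (CategoryTheory.CategoryStruct.comp ι (AlgebraicGeometry.Proj.map φ hφ') : H ⟶ (AlgebraicGeometry.Proj (MvPolynomial.homogeneousSubmodule (Fin (n + 1)) O))) → ∃ (P' : AlgebraicGeometry.Scheme.{0}) (σ : P' ⟶ (AlgebraicGeometry.Proj (MvPolynomial.homogeneousSubmodule (Fin (n + 1)) O))) (S' : Set P'), (∀ Q : (∀ X' : AlgebraicGeometry.Scheme.{0}, (X' ⟶ (AlgebraicGeometry.Proj (MvPolynomial.homogeneousSubmodule (Fin (n + 1)) O))) → Set X' → Prop), Q (AlgebraicGeometry.Proj (MvPolynomial.homogeneousSubmodule (Fin (n + 1)) O)) (CategoryTheory.CategoryStruct.id _) Y → (∀ (X' X'' : AlgebraicGeometry.Scheme.{0}) (σ'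 : X' ⟶ (AlgebraicGeometry.Proj (MvPolynomial.homogeneousSubmodule (Fin (n + 1)) O))) (Y' : Set X') (C : X'.IdealSheafData) (τ : X'' ⟶ X'), Q X' σ' Y' → Literature.AlgebraicGeometry.Resolution.IsBlowup τ C → Literature.AlgebraicGeometry.Resolution.Scheme.IsRegular C.subscheme → AlgebraicGeometry.Flat (CategoryTheory.CategoryStruct.comp C.subschemeι (CategoryTheory.CategoryStruct.comp σ' (CategoryTheory.CategoryStruct.comp (AlgebraicGeometry.Proj.toSpecZero (MvPolynomial.homogeneousSubmodule (Fin (n + 1)) O)) (AlgebraicGeometry.Spec.map (CommRingCat.ofHom (algebraMap O (MvPolynomial.homogeneousSubmodule (Fin (n + 1)) O 0))))))) → σ' '' (C.support : Set X') ⊆ {x | ¬ IsGenericPoint x Y} → (C.support : Set X') ∩ (CategoryTheory.CategoryStruct.comp σ' (CategoryTheory.CategoryStruct.comp (AlgebraicGeometry.Proj.toSpecZero (MvPolynomial.homogeneousSubmodule (Fin (n + 1)) O)) (AlgebraicGeometry.Spec.map (CommRingCat.ofHom (algebraMap O (MvPolynomial.homogeneousSubmodule (Fin (n + 1)) O 0))))))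 ⁻¹' {IsLocalRing.closedPoint O} ⊆ Y' → Q X'' (CategoryTheory.CategoryStruct.comp τ σ') (closure (τ ⁻¹' (Y' \ (C.support : Set X'))))) → Q P' σ S') ∧ Literature.AlgebraicGeometry.Resolution.Scheme.IsRegular (AlgebraicGeometry.Scheme.IdealSheafData.vanishingIdeal (⟨closure S', isClosed_closure⟩ : TopologicalSpace.Closeds P')).subscheme) := by
  classical
  intro hp k _ _ _ n H ι hι hH hpr hreach
  obtain ⟨Z, hZ, hcls, hZsub, hZnsub, hZinf, -, F₂, υ, hυ, F', γ', T', E', K', htower, hregD⟩ := hreach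
  obtain ⟨O, i1, i2, i3, i4, i5, i6, π, hπ⟩ := stub_wittRing p hp k
  -- the LIFT of the nose class over `(O, π)` (res-type-051): an `O`-smooth centre `C ⊂ ℙⁿ_O` with exact trace `𝓘⟨Z⟩` along every graded `φ`
  have hLIFT : IsLiftableCentre k n Z hZ := lift_of_isLiftableNoseClass₂ k n hcls hZ
  obtain ⟨C, hCsm, hKEY⟩ := hLIFT O π hπ
  refine ⟨O, i1, i2, i3, i4, π, hπ, ?_⟩
  letI := MvPolynomial.gradedAlgebra (σ := Fin (n + 1)) (R := O)
  letI := MvPolynomial.gradedAlgebra (σ := Fin (n + 1)) (R := k)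
  intro φ hφ' hφ Y hYdef
  subst hYdef
  -- K5′'s frame VERBATIM: the fixed ambient `P = ℙⁿ_O`, `q`, and the BASE MODEL SQUARE `g : ℙⁿ_k → ℙⁿ_O`
  set q : Proj (homogeneousSubmodule (Fin (n + 1)) O) ⟶ Spec (.of O) :=
    Proj.toSpecZero (homogeneousSubmodule (Fin (n + 1)) O) ≫
      Spec.map (CommRingCat.ofHom (algebraMap O (homogeneousSubmodule (Fin (n + 1)) O 0))) with hq
  have hP := ProjectiveAmbientFibre.isPullback_projMap π φ hφ hπ hφ'
  set g : Proj (homogeneousSubmodule (Fin (n + 1)) k) ⟶ Proj (homogeneousSubmodule (Fin (n + 1)) O) :=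
    Proj.map φ hφ' with hg
  haveI : IsClosedImmersion (Spec.map (CommRingCat.ofHom π)) := IsClosedImmersion.spec_of_surjective _ hπ
  haveI : IsClosedImmersion g := MorphismProperty.IsStableUnderBaseChange.of_isPullback hP.flip inferInstance
  have hsq₀ : IsPullback g (Proj.toSpecZero (homogeneousSubmodule (Fin (n + 1)) k) ≫
      Spec.map (CommRingCat.ofHom (algebraMap k (homogeneousSubmodule (Fin (n + 1)) k 0))))
      (𝟙 _ ≫ q) (Spec.map (CommRingCat.ofHom π)) := by
    rw [Category.id_comp]; exact hP
  have hrangeg : Set.range g = q ⁻¹' {IsLocalRing.closedPoint O} := by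
    rw [range_eq_preimage_of_isPullback hP, range_specMap_of_surjective_of_field π hπ]
  -- the closed immersion `f = ι ≫ g : H ⟶ ℙⁿ_O` and its (closed) range `Y`
  haveI := hH
  let ι' : H ⟶ Proj (homogeneousSubmodule (Fin (n + 1)) k) := ι
  haveI : IsClosedImmersion ι' := hι
  let f : H ⟶ Proj (homogeneousSubmodule (Fin (n + 1)) O) := ι' ≫ g
  let Yc : Closeds (Proj (homogeneousSubmodule (Fin (n + 1)) O)) := ⟨Set.range f, f.isClosedEmbedding.isClosed_range⟩
  have hYs : (Yc : Set (Proj (homogeneousSubmodule (Fin (n + 1)) O))) ⊆ q ⁻¹' {IsLocalRing.closedPoint O} := by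
    rintro _ ⟨x, rfl⟩
    rw [← hrangeg]
    exact ⟨ι' x, (Scheme.Hom.comp_apply _ _ x).symm⟩
  obtain ⟨hsm, hprop⟩ := stub_projectiveAmbientSmoothProper O n
  haveI : IsProper q := hprop
  -- `Y` is irreducible (image of the integral `H`), with generic point `f η`
  have hgenY : IsGenericPoint (f (genericPoint H)) (Yc : Set (Proj (homogeneousSubmodule (Fin (n + 1)) O))) := by
    have h := (genericPoint_spec H).image f.continuous
    rw [Set.image_univ, f.isClosedEmbedding.isClosed_range.closure_eq] at h
    exact h
  have hYirr : IsIrreducible (Yc : Set (Proj (homogeneousSubmodule (Fin (n + 1)) O))) := by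
    have h := (IrreducibleSpace.isIrreducible_univ H).image f f.continuous.continuousOn
    rwa [Set.image_univ] at h
  have hgenι : IsGenericPoint (ι' (genericPoint H)) (Set.range ι') := by
    have h := (genericPoint_spec H).image ι'.continuous
    rwa [Set.image_univ, ι'.isClosedEmbedding.isClosed_range.closure_eq] at h
  -- EL♮'s HORIZONTAL induction principle as a stage predicate over the fixed base
  obtain ⟨Ch, hCh⟩ : ∃ Ch : ∀ X' : Scheme.{0}, (X' ⟶ Proj (homogeneousSubmodule (Fin (n + 1)) O)) → Set X' → Prop,
      ∀ (X₁ : Scheme.{0}) (σ₁ : X₁ ⟶ Proj (homogeneousSubmodule (Fin (n + 1)) O)) (S₁ : Set X₁), Ch X₁ σ₁ S₁ ↔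
      ∀ Q : (∀ X' : Scheme.{0}, (X' ⟶ Proj (homogeneousSubmodule (Fin (n + 1)) O)) → Set X' → Prop),
        Q (Proj (homogeneousSubmodule (Fin (n + 1)) O)) (𝟙 _) (Yc : Set (Proj (homogeneousSubmodule (Fin (n + 1)) O))) →
        (∀ (X' X'' : Scheme.{0}) (σ' : X' ⟶ Proj (homogeneousSubmodule (Fin (n + 1)) O)) (Y' : Set X')
          (C : X'.IdealSheafData) (τ : X'' ⟶ X'), Q X' σ' Y' → IsBlowup τ C → Scheme.IsRegular C.subscheme →
          Flat (C.subschemeι ≫ σ' ≫ q) →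
          σ' '' (C.support : Set X') ⊆ {x | ¬ IsGenericPoint x (Yc : Set (Proj (homogeneousSubmodule (Fin (n + 1)) O)))} →
          (C.support : Set X') ∩ (σ' ≫ q) ⁻¹' {IsLocalRing.closedPoint O} ⊆ Y' →
          Q X'' (τ ≫ σ') (closure (τ ⁻¹' (Y' \ (C.support : Set X'))))) →
        Q X₁ σ₁ S₁ := ⟨_, fun _ _ _ => Iff.rfl⟩
  have hChain : ∀ (X' : Scheme.{0}) (σ : X' ⟶ Proj (homogeneousSubmodule (Fin (n + 1)) O)) (S : Set X'),
      Ch X' σ S → Chain (Proj (homogeneousSubmodule (Fin (n + 1)) O))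
        (Yc : Set (Proj (homogeneousSubmodule (Fin (n + 1)) O))) X' σ S :=
    fun X' σ S h Q h0 hs => (hCh X' σ S).mp h Q h0
      (fun X₁ X₂ σ' Y' C τ hQ hb hr _ hg' _ => hs X₁ X₂ σ' Y' C τ hQ hb hr hg')
  have hStep : ∀ (X' X'' : Scheme.{0}) (σ' : X' ⟶ Proj (homogeneousSubmodule (Fin (n + 1)) O)) (S' : Set X')
      (C : X'.IdealSheafData) (τ : X'' ⟶ X'),
      Ch X' σ' S' → IsBlowup τ C → Scheme.IsRegular C.subscheme → Flat (C.subschemeι ≫ σ' ≫ q) →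
      σ' '' (C.support : Set X') ⊆ {x | ¬ IsGenericPoint x (Yc : Set (Proj (homogeneousSubmodule (Fin (n + 1)) O)))} →
      (C.support : Set X') ∩ (σ' ≫ q) ⁻¹' {IsLocalRing.closedPoint O} ⊆ S' →
      Ch X'' (τ ≫ σ') (closure (τ ⁻¹' (S' \ (C.support : Set X')))) :=
    fun X' X'' σ' S' C τ h hb hr hfl hg' hE => (hCh _ _ _).mpr fun Q h0 hs =>
      hs X' X'' σ' S' C τ ((hCh X' σ' S').mp h Q h0 hs) hb hr hfl hg' hE
  have hCh₀ : Ch (Proj (homogeneousSubmodule (Fin (n + 1)) O)) (𝟙 _)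
      (Yc : Set (Proj (homogeneousSubmodule (Fin (n + 1)) O))) := (hCh _ _ _).mpr fun Q h0 _ => h0
  haveI hPnoeth : IsLocallyNoetherian (Proj (homogeneousSubmodule (Fin (n + 1)) O)) :=
    LocallyOfFiniteType.isLocallyNoetherian q
  have hPreg : Scheme.IsRegular (Proj (homogeneousSubmodule (Fin (n + 1)) O)) := fun y => (stub_goodAtOfSmooth O _ q hsm y).1
  haveI hPint : IsIntegral (Proj (homogeneousSubmodule (Fin (n + 1)) O)) :=
    Proj.isIntegral _ (irrelevant_homogeneousSubmodule_ne_bot n O)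
  haveI hsrd : SmoothOfRelativeDimension n q := smoothOfRelativeDimension_toSpecZero_specMap n O
  -- the base stage `(ℙⁿ_O, 𝟙, Y)` and its model `(ℙⁿ_k, range ι)`
  haveI : Nonempty H := inferInstance
  haveI : Nonempty (Proj (homogeneousSubmodule (Fin (n + 1)) O)) := ⟨f (Classical.arbitrary H)⟩
  haveI : Smooth q := hsm
  haveI : IsDominant q := isDominant_of_smooth_of_nonempty q
  have hdom₀ : IsDominant (𝟙 (Proj (homogeneousSubmodule (Fin (n + 1)) O)) ≫ q) := by
    rw [Category.id_comp]; infer_instance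
  have hirrι : IsIrreducible (Set.range ι') := by
    have h := (IrreducibleSpace.isIrreducible_univ H).image ι' ι'.continuous.continuousOn
    rwa [Set.image_univ] at h
  have hT₁cl : IsClosed (Set.range ι') := ι'.isClosedEmbedding.isClosed_range
  haveI hF₁ : IsIntegral (Proj (homogeneousSubmodule (Fin (n + 1)) k)) := isIntegral_proj_homogeneousSubmodule n k
  have hTS : g '' Set.range ι' = (Yc : Set (Proj (homogeneousSubmodule (Fin (n + 1)) O))) := by
    change g '' Set.range ι' = Set.range f
    rw [← Set.range_comp]
    rfl
  -- THE NOSE: exact trace `𝓘⟨Z⟩`, regular and `O`-flat (smooth over the regular `O`), off the generic point of `Y`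
  have hK : C.comap g = vanishingIdeal (⟨Z, hZ⟩ : Closeds (Proj (homogeneousSubmodule (Fin (n + 1)) k))) := hKEY φ hφ' hφ
  have hsuppZ : ((vanishingIdeal (⟨Z, hZ⟩ : Closeds (Proj (homogeneousSubmodule (Fin (n + 1)) k)))).support :
      Set (Proj (homogeneousSubmodule (Fin (n + 1)) k))) = Z :=
    Scheme.IdealSheafData.coe_support_vanishingIdeal _
  have hpreC : g ⁻¹' (C.support : Set (Proj (homogeneousSubmodule (Fin (n + 1)) O))) = Z := by
    have h := Scheme.IdealSheafData.support_comap C g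
    rw [hK] at h
    rw [← hsuppZ, h]
    rfl
  have hCsm₁ : Smooth (C.subschemeι ≫ 𝟙 (Proj (homogeneousSubmodule (Fin (n + 1)) O)) ≫ q) := by
    rw [Category.id_comp]; exact hCsm
  haveI : IsRegularRing (CommRingCat.of O) := inferInstanceAs (IsRegularRing O)
  have hCreg : Scheme.IsRegular C.subscheme :=
    Scheme.IsRegular.of_smooth (C.subschemeι ≫ 𝟙 (Proj (homogeneousSubmodule (Fin (n + 1)) O)) ≫ q) (Scheme.isRegular_Spec (.of O))
  have hCflat : Flat (C.subschemeι ≫ 𝟙 (Proj (homogeneousSubmodule (Fin (n + 1)) O)) ≫ q) := inferInstance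
  have hoffpt : ∀ c ∈ (C.support : Set (Proj (homogeneousSubmodule (Fin (n + 1)) O))),
      ¬ IsGenericPoint ((𝟙 (Proj (homogeneousSubmodule (Fin (n + 1)) O)) : _ ⟶ _) c)
        (Yc : Set (Proj (homogeneousSubmodule (Fin (n + 1)) O))) := by
    intro c hc hgen
    change IsGenericPoint c (Yc : Set (Proj (homogeneousSubmodule (Fin (n + 1)) O))) at hgen
    have hce : c = f (genericPoint H) := hgen.eq hgenY
    have hmem : ι' (genericPoint H) ∈ g ⁻¹' (C.support : Set (Proj (homogeneousSubmodule (Fin (n + 1)) O))) := by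
      change g (ι' (genericPoint H)) ∈ (C.support : Set (Proj (homogeneousSubmodule (Fin (n + 1)) O)))
      rw [← Scheme.Hom.comp_apply, ← hce]
      exact hc
    rw [hpreC] at hmem
    apply hZnsub
    change Set.range ι' ⊆ Z
    rw [← hgenι]
    exact closure_minimal (Set.singleton_subset_iff.mpr hmem) hZ
  have hoff : (𝟙 (Proj (homogeneousSubmodule (Fin (n + 1)) O)) : _ ⟶ _) '' (C.support : Set (Proj (homogeneousSubmodule (Fin (n + 1)) O))) ⊆
      {x | ¬ IsGenericPoint x (Yc : Set (Proj (homogeneousSubmodule (Fin (n + 1)) O)))} := by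
    rintro _ ⟨c, hc, rfl⟩
    exact hoffpt c hc
  have hDT : ((vanishingIdeal (⟨Z, hZ⟩ : Closeds (Proj (homogeneousSubmodule (Fin (n + 1)) k)))).support :
      Set (Proj (homogeneousSubmodule (Fin (n + 1)) k))) ⊆ Set.range ι' := by
    rw [hsuppZ]; exact hZsub
  have hTD : ¬ (Set.range ι' ⊆ ((vanishingIdeal (⟨Z, hZ⟩ : Closeds (Proj (homogeneousSubmodule (Fin (n + 1)) k)))).support :
      Set (Proj (homogeneousSubmodule (Fin (n + 1)) k)))) := by
    rw [hsuppZ]; exact hZnsub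
  -- THE NOSE STEP in chain currency (res-D-pv-029's `modelStep_chain`): blow `ℙⁿ_O` up along `C`; the model square of the given `υ`
  obtain ⟨X₁, τ₁, hτ₁⟩ := exists_isBlowup (Proj (homogeneousSubmodule (Fin (n + 1)) O)) C
  obtain ⟨hint₁, hnoeth₁, hreg₁, hdom₁, hF₂, hirr₂, j₂, t₂, hsq₂, hcomm, hCh₁⟩ :=
    modelStep_chain O k π hπ _ q (Yc : Set (Proj (homogeneousSubmodule (Fin (n + 1)) O))) hYirr Yc.isClosed Ch hChain hStep
      _ (𝟙 _) (Yc : Set (Proj (homogeneousSubmodule (Fin (n + 1)) O))) hCh₀ hPreg hdom₀ _ g _ hsq₀ (Set.range ι') hTS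
      C (vanishingIdeal (⟨Z, hZ⟩ : Closeds (Proj (homogeneousSubmodule (Fin (n + 1)) k)))) hK hCreg hCflat hoff hDT hTD
      X₁ τ₁ hτ₁ F₂ υ hυ
  rw [hsuppZ] at hirr₂ hCh₁
  -- the exceptional identity `(C · 𝒪_{X₁}) · 𝒪_{F₂} = 𝓘⟨Z⟩ · 𝒪_{F₂}`
  have hE : (C.comap τ₁).comap j₂ =
      (vanishingIdeal (⟨Z, hZ⟩ : Closeds (Proj (homogeneousSubmodule (Fin (n + 1)) k)))).comap υ := by
    rw [← Scheme.IdealSheafData.comap_comp, hcomm, Scheme.IdealSheafData.comap_comp, hK]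
  -- ONE CALL of the sub-chain supplier HSUB′(ReachNoseTower₃) on the tower datum of `ReachNoseTower₃`
  obtain ⟨X₉, σ₉, S₉, j₉, t₉, hCh₉, -, -, -, -, hsq₉, hsets₉, hT'cl, -, -⟩ :=
    hsub k n O π hπ _ q (Yc : Set (Proj (homogeneousSubmodule (Fin (n + 1)) O))) Ch hStep hChain hYs hYirr Yc.isClosed
      hPint hPnoeth hPreg hprop hsrd _ (𝟙 _) (Yc : Set (Proj (homogeneousSubmodule (Fin (n + 1)) O))) hCh₀ hPint hPnoeth hPreg hdom₀
      _ hF₁ g _ hsq₀ (Set.range ι') hT₁cl hirrι hTS Z hZ hZsub hZnsub hZinf C hCsm₁ hCreg hCflat hK hoffpt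
      X₁ τ₁ hτ₁ hint₁ hnoeth₁ hreg₁ hdom₁ F₂ hF₂ υ hυ j₂ t₂ hsq₂ hcomm hE hirr₂ hCh₁ F' γ' T' E' K' htower
  -- THE END (K5′ verbatim): transport the downstairs regularity through the model square
  haveI hj₉ci : IsClosedImmersion j₉ := MorphismProperty.IsStableUnderBaseChange.of_isPullback hsq₉.flip inferInstance
  have hT'img : IsClosed (j₉ '' T') := hj₉ci.isClosedEmbedding.isClosedMap _ hT'cl
  have hZ1 : (⟨closure T', isClosed_closure⟩ : Closeds F') = ⟨T', hT'cl⟩ := Closeds.ext hT'cl.closure_eq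
  have hZ2 : (⟨closure S₉, isClosed_closure⟩ : Closeds X₉) = ⟨j₉ '' T', hT'img⟩ :=
    Closeds.ext (by change closure S₉ = j₉ '' T'; rw [← hsets₉]; exact hT'img.closure_eq)
  change Scheme.IsRegular (vanishingIdeal (⟨closure T', isClosed_closure⟩ : Closeds F')).subscheme at hregD
  rw [hZ1] at hregD
  refine ⟨X₉, σ₉, S₉, (hCh X₉ σ₉ S₉).mp hCh₉, ?_⟩
  rw [hZ2]
  exact (isRegular_subscheme_vanishingIdeal_image_iff j₉ ⟨T', hT'cl⟩ hT'img).mpr hregD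

/-- **NOSE-TOWER₃-INST, per-`(k, n)` form** (res-L1-w45b-lead-2's p564140 pattern: the supplier hypothesis sits INSIDE the binder chain, after the
local-principality clause, so that an assembly proved for ONE algebraically closed `k` and ONE `n` — the NOSETOWER₃ assembly works at `n = 3` — closes
the `n = 3` instance of the rung by `fun hp k _ _ _ H ι hι hH hloc => this p hp k 3 H ι hι hH hloc (assembly k …)`): TARGET-RATNOSETOWER3's text with
HSUB′(ReachNoseTower₃)'s body (cad6759341cbb034 minus its leading `∀ (k : Type) [Field k] (n : ℕ),`) inserted before `ReachNoseTower₃ k n H ι`.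
Same proof as `stub_elnat_ratNoseTowerResolution_of_subchainLift₃`. [folklore; pure assembly] [OURS · L1 W4.5b] -/
theorem stub_elnat_ratNoseTowerResolution_of_subchainLiftAt₃ (p : ℕ) :
    p.Prime → ∀ (k : Type) [Field k] [CharP k p] [IsAlgClosed k] (n : ℕ) (H : AlgebraicGeometry.Scheme.{0}) (ι : H ⟶ (Literature.AlgebraicGeometry.Motives.projectiveSpace n k).left), AlgebraicGeometry.IsClosedImmersion ι → AlgebraicGeometry.IsIntegral H → (∀ y : (Literature.AlgebraicGeometry.Motives.projectiveSpace n k).left, ∃ U : (Literature.AlgebraicGeometry.Motives.projectiveSpace n k).left.affineOpens, y ∈ (U : (Literature.AlgebraicGeometry.Motives.projectiveSpace n k).left.Opens) ∧ (ι.ker.ideal U).IsPrincipal) → (∀ (O : Type) [CommRing O] [IsDomain O] [IsDiscreteValuationRing O] [IsAdicComplete (IsLocalRing.maximalIdeal O) O] [IsAlgClosed (IsLocalRing.ResidueField O)] (θ : O →+* k), Function.Surjective θ → ∀ (P : AlgebraicGeometry.Scheme.{0}) (q : P ⟶ AlgebraicGeometry.Spec (.of O)) (Y : Set P) (Ch :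 ∀ X' : AlgebraicGeometry.Scheme.{0}, (X' ⟶ P) → Set X' → Prop), (∀ (X' X'' : AlgebraicGeometry.Scheme.{0}) (σ' : X' ⟶ P) (S' : Set X') (C : X'.IdealSheafData) (τ : X'' ⟶ X'), Ch X' σ' S' → Literature.AlgebraicGeometry.Resolution.IsBlowup τ C → Literature.AlgebraicGeometry.Resolution.Scheme.IsRegular C.subscheme → AlgebraicGeometry.Flat (C.subschemeι ≫ σ' ≫ q) → σ' '' (C.support : Set X') ⊆ {y | ¬ IsGenericPoint y Y} → (C.support : Set X') ∩ (σ' ≫ q) ⁻¹' {IsLocalRing.closedPoint O} ⊆ S' → Ch X'' (τ ≫ σ') (closure (τ ⁻¹' (S' \ (C.support : Set X'))))) → (∀ (X' : AlgebraicGeometry.Scheme.{0}) (σ' : X' ⟶ P) (S' : Set X'), Ch X' σ' S' → Summit.ResolutionOfSingularities.ResolutionOfSingularities.Theses.EquisingularLift.Split.Chain P Y X' σ' S') → Y ⊆ q ⁻¹' {IsLocalRing.closedPoint O} → IsIrreducible Y → IsClosed Y → AlgebraicGeometry.IsIntegral P → IsLocallyNoetherian P → Literature.AlgebraicGeometry.Resolution.Scheme.IsRegular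 P → AlgebraicGeometry.IsProper q → AlgebraicGeometry.SmoothOfRelativeDimension n q → ∀ (X' : AlgebraicGeometry.Scheme.{0}) (σ' : X' ⟶ P) (S' : Set X'), Ch X' σ' S' → AlgebraicGeometry.IsIntegral X' → IsLocallyNoetherian X' → Literature.AlgebraicGeometry.Resolution.Scheme.IsRegular X' → AlgebraicGeometry.IsDominant (σ' ≫ q) → ∀ (F₁ : AlgebraicGeometry.Scheme.{0}), AlgebraicGeometry.IsIntegral F₁ → ∀ (j : F₁ ⟶ X') (t : F₁ ⟶ AlgebraicGeometry.Spec (.of k)), IsPullback j t (σ' ≫ q) (AlgebraicGeometry.Spec.map (CommRingCat.ofHom θ)) → ∀ (T₁ : Set F₁), IsClosed T₁ → IsIrreducible T₁ → j '' T₁ = S' → ∀ (Z : Set F₁) (hZ : IsClosed Z), Z ⊆ T₁ → ¬ (T₁ ⊆ Z) → Z.Infinite → ∀ (C : X'.IdealSheafData), AlgebraicGeometry.Smooth (C.subschemeι ≫ σ' ≫ q) → Literature.AlgebraicGeometry.Resolution.Scheme.IsRegular C.subscheme → AlgebraicGeometry.Flat (C.subschemeι ≫ σ' ≫ q) → C.comap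 j = AlgebraicGeometry.Scheme.IdealSheafData.vanishingIdeal (⟨Z, hZ⟩ : TopologicalSpace.Closeds F₁) → (∀ c ∈ (C.support : Set X'), ¬ IsGenericPoint (σ' c) Y) → ∀ (X₁ : AlgebraicGeometry.Scheme.{0}) (τ₁ : X₁ ⟶ X'), Literature.AlgebraicGeometry.Resolution.IsBlowup τ₁ C → AlgebraicGeometry.IsIntegral X₁ → IsLocallyNoetherian X₁ → Literature.AlgebraicGeometry.Resolution.Scheme.IsRegular X₁ → AlgebraicGeometry.IsDominant ((τ₁ ≫ σ') ≫ q) → ∀ (F₂ : AlgebraicGeometry.Scheme.{0}), AlgebraicGeometry.IsIntegral F₂ → ∀ (υ : F₂ ⟶ F₁), Literature.AlgebraicGeometry.Resolution.IsBlowup υ (AlgebraicGeometry.Scheme.IdealSheafData.vanishingIdeal (⟨Z, hZ⟩ : TopologicalSpace.Closeds F₁)) → ∀ (j₂ : F₂ ⟶ X₁) (t₂ : F₂ ⟶ AlgebraicGeometry.Spec (.of k)), IsPullback j₂ t₂ ((τ₁ ≫ σ') ≫ q) (AlgebraicGeometry.Spec.map (CommRingCat.ofHom θ)) → j₂ ≫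 τ₁ = υ ≫ j → (C.comap τ₁).comap j₂ = (AlgebraicGeometry.Scheme.IdealSheafData.vanishingIdeal (⟨Z, hZ⟩ : TopologicalSpace.Closeds F₁)).comap υ → IsIrreducible (closure (υ ⁻¹' (T₁ \ Z))) → Ch X₁ (τ₁ ≫ σ') (j₂ '' closure (υ ⁻¹' (T₁ \ Z))) →
      ∀ (F' : AlgebraicGeometry.Scheme.{0}) (γ' : F' ⟶ F₂) (T' E' K' : Set F'), (∀ R₁ : (∀ G : AlgebraicGeometry.Scheme.{0}, (G ⟶ F₂) → Set G → Set G → Set G → Prop), R₁ F₂ (𝟙 F₂) (closure (υ ⁻¹' (T₁ \ Z))) (υ ⁻¹' Z) ∅ → TowerPtReg₂ F₁ F₂ υ R₁ → TowerPtRam₂ F₁ F₂ υ R₁ → TowerRound₂ F₁ F₂ υ Z hZ R₁ → R₁ F' γ' T' E' K') → ∃ (X₉ : AlgebraicGeometry.Scheme.{0}) (σ₉ : X₉ ⟶ P) (S₉ : Set X₉) (j₉ : F' ⟶ X₉) (t₉ : F' ⟶ AlgebraicGeometry.Spec (.of k)), Ch X₉ σ₉ S₉ ∧ AlgebraicGeometry.IsIntegral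 X₉ ∧ IsLocallyNoetherian X₉ ∧ Literature.AlgebraicGeometry.Resolution.Scheme.IsRegular X₉ ∧ AlgebraicGeometry.IsDominant (σ₉ ≫ q) ∧ IsPullback j₉ t₉ (σ₉ ≫ q) (AlgebraicGeometry.Spec.map (CommRingCat.ofHom θ)) ∧ j₉ '' T' = S₉ ∧ IsClosed T' ∧ IsIrreducible T' ∧ AlgebraicGeometry.IsIntegral F') → (ReachNoseTower₃ k n H ι) → ∃ (O : Type) (_ : CommRing O) (_ : IsDomain O) (_ : IsDiscreteValuationRing O) (_ : CharZero O) (π : O →+* k), Function.Surjective π ∧ (letI := MvPolynomial.gradedAlgebra (σ := Fin (n + 1)) (R := O); letI := MvPolynomial.gradedAlgebra (σ := Fin (n + 1)) (R := k); ∀ (φ : MvPolynomial.homogeneousSubmodule (Fin (n + 1)) O →+*ᵍ MvPolynomial.homogeneousSubmodule (Fin (n + 1)) k) (hφ' : HomogeneousIdeal.irrelevant (MvPolynomial.homogeneousSubmodule (Fin (n + 1)) k) ≤ (HomogeneousIdeal.irrelevant (MvPolynomial.homogeneousSubmodule (Fin (n + 1)) O)).map φ), (∀ s, φ s = MvPolynomial.map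 π s) → ∀ Y : Set (AlgebraicGeometry.Proj (MvPolynomial.homogeneousSubmodule (Fin (n + 1)) O)), Y = Set.range (CategoryTheory.CategoryStruct.comp ι (AlgebraicGeometry.Proj.map φ hφ') : H ⟶ (AlgebraicGeometry.Proj (MvPolynomial.homogeneousSubmodule (Fin (n + 1)) O))) → ∃ (P' : AlgebraicGeometry.Scheme.{0}) (σ : P' ⟶ (AlgebraicGeometry.Proj (MvPolynomial.homogeneousSubmodule (Fin (n + 1)) O))) (S' : Set P'), (∀ Q : (∀ X' : AlgebraicGeometry.Scheme.{0}, (X' ⟶ (AlgebraicGeometry.Proj (MvPolynomial.homogeneousSubmodule (Fin (n + 1)) O))) → Set X' → Prop), Q (AlgebraicGeometry.Proj (MvPolynomial.homogeneousSubmodule (Fin (n + 1)) O)) (CategoryTheory.CategoryStruct.id _) Y → (∀ (X' X'' : AlgebraicGeometry.Scheme.{0}) (σ' : X' ⟶ (AlgebraicGeometry.Proj (MvPolynomial.homogeneousSubmodule (Fin (n + 1)) O))) (Y' : Set X') (C : X'.IdealSheafData) (τ : X'' ⟶ X'), Q X' σ' Y' → Literature.AlgebraicGeometry.Resolution.IsBlowup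 τ C → Literature.AlgebraicGeometry.Resolution.Scheme.IsRegular C.subscheme → AlgebraicGeometry.Flat (CategoryTheory.CategoryStruct.comp C.subschemeι (CategoryTheory.CategoryStruct.comp σ' (CategoryTheory.CategoryStruct.comp (AlgebraicGeometry.Proj.toSpecZero (MvPolynomial.homogeneousSubmodule (Fin (n + 1)) O)) (AlgebraicGeometry.Spec.map (CommRingCat.ofHom (algebraMap O (MvPolynomial.homogeneousSubmodule (Fin (n + 1)) O 0))))))) → σ' '' (C.support : Set X') ⊆ {x | ¬ IsGenericPoint x Y} → (C.support : Set X') ∩ (CategoryTheory.CategoryStruct.comp σ' (CategoryTheory.CategoryStruct.comp (AlgebraicGeometry.Proj.toSpecZero (MvPolynomial.homogeneousSubmodule (Fin (n + 1)) O)) (AlgebraicGeometry.Spec.map (CommRingCat.ofHom (algebraMap O (MvPolynomial.homogeneousSubmodule (Fin (n + 1)) O 0)))))) ⁻¹' {IsLocalRing.closedPoint O} ⊆ Y' → Q X'' (CategoryTheory.CategoryStruct.comp τ σ') (closure (τ ⁻¹' (Y' \ (C.support : Set X'))))) → Q P' σ S') ∧ Literature.AlgebraicGeometry.Resolution.Scheme.IsRegular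 (AlgebraicGeometry.Scheme.IdealSheafData.vanishingIdeal (⟨closure S', isClosed_closure⟩ : TopologicalSpace.Closeds P')).subscheme) := by
  classical
  intro hp k _ _ _ n H ι hι hH hpr hsub hreach
  obtain ⟨Z, hZ, hcls, hZsub, hZnsub, hZinf, -, F₂, υ, hυ, F', γ', T', E', K', htower, hregD⟩ := hreach
  obtain ⟨O, i1, i2, i3, i4, i5, i6, π, hπ⟩ := stub_wittRing p hp k
  have hLIFT : IsLiftableCentre k n Z hZ := lift_of_isLiftableNoseClass₂ k n hcls hZ
  obtain ⟨C, hCsm, hKEY⟩ := hLIFT O π hπ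
  refine ⟨O, i1, i2, i3, i4, π, hπ, ?_⟩
  letI := MvPolynomial.gradedAlgebra (σ := Fin (n + 1)) (R := O)
  letI := MvPolynomial.gradedAlgebra (σ := Fin (n + 1)) (R := k)
  intro φ hφ' hφ Y hYdef
  subst hYdef
  set q : Proj (homogeneousSubmodule (Fin (n + 1)) O) ⟶ Spec (.of O) :=
    Proj.toSpecZero (homogeneousSubmodule (Fin (n + 1)) O) ≫
      Spec.map (CommRingCat.ofHom (algebraMap O (homogeneousSubmodule (Fin (n + 1)) O 0))) with hq
  have hP := ProjectiveAmbientFibre.isPullback_projMap π φ hφ hπ hφ'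
  set g : Proj (homogeneousSubmodule (Fin (n + 1)) k) ⟶ Proj (homogeneousSubmodule (Fin (n + 1)) O) :=
    Proj.map φ hφ' with hg
  haveI : IsClosedImmersion (Spec.map (CommRingCat.ofHom π)) := IsClosedImmersion.spec_of_surjective _ hπ
  haveI : IsClosedImmersion g := MorphismProperty.IsStableUnderBaseChange.of_isPullback hP.flip inferInstance
  have hsq₀ : IsPullback g (Proj.toSpecZero (homogeneousSubmodule (Fin (n + 1)) k) ≫
      Spec.map (CommRingCat.ofHom (algebraMap k (homogeneousSubmodule (Fin (n + 1)) k 0))))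
      (𝟙 _ ≫ q) (Spec.map (CommRingCat.ofHom π)) := by
    rw [Category.id_comp]; exact hP
  have hrangeg : Set.range g = q ⁻¹' {IsLocalRing.closedPoint O} := by
    rw [range_eq_preimage_of_isPullback hP, range_specMap_of_surjective_of_field π hπ]
  haveI := hH
  let ι' : H ⟶ Proj (homogeneousSubmodule (Fin (n + 1)) k) := ι
  haveI : IsClosedImmersion ι' := hι
  let f : H ⟶ Proj (homogeneousSubmodule (Fin (n + 1)) O) := ι' ≫ g
  let Yc : Closeds (Proj (homogeneousSubmodule (Fin (n + 1)) O)) := ⟨Set.range f, f.isClosedEmbedding.isClosed_range⟩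
  have hYs : (Yc : Set (Proj (homogeneousSubmodule (Fin (n + 1)) O))) ⊆ q ⁻¹' {IsLocalRing.closedPoint O} := by
    rintro _ ⟨x, rfl⟩
    rw [← hrangeg]
    exact ⟨ι' x, (Scheme.Hom.comp_apply _ _ x).symm⟩
  obtain ⟨hsm, hprop⟩ := stub_projectiveAmbientSmoothProper O n
  haveI : IsProper q := hprop
  have hgenY : IsGenericPoint (f (genericPoint H)) (Yc : Set (Proj (homogeneousSubmodule (Fin (n + 1)) O))) := by
    have h := (genericPoint_spec H).image f.continuous
    rw [Set.image_univ, f.isClosedEmbedding.isClosed_range.closure_eq] at h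
    exact h
  have hYirr : IsIrreducible (Yc : Set (Proj (homogeneousSubmodule (Fin (n + 1)) O))) := by
    have h := (IrreducibleSpace.isIrreducible_univ H).image f f.continuous.continuousOn
    rwa [Set.image_univ] at h
  have hgenι : IsGenericPoint (ι' (genericPoint H)) (Set.range ι') := by
    have h := (genericPoint_spec H).image ι'.continuous
    rwa [Set.image_univ, ι'.isClosedEmbedding.isClosed_range.closure_eq] at h
  obtain ⟨Ch, hCh⟩ : ∃ Ch : ∀ X' : Scheme.{0}, (X' ⟶ Proj (homogeneousSubmodule (Fin (n + 1)) O)) → Set X' → Prop,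
      ∀ (X₁ : Scheme.{0}) (σ₁ : X₁ ⟶ Proj (homogeneousSubmodule (Fin (n + 1)) O)) (S₁ : Set X₁), Ch X₁ σ₁ S₁ ↔
      ∀ Q : (∀ X' : Scheme.{0}, (X' ⟶ Proj (homogeneousSubmodule (Fin (n + 1)) O)) → Set X' → Prop),
        Q (Proj (homogeneousSubmodule (Fin (n + 1)) O)) (𝟙 _) (Yc : Set (Proj (homogeneousSubmodule (Fin (n + 1)) O))) →
        (∀ (X' X'' : Scheme.{0}) (σ' : X' ⟶ Proj (homogeneousSubmodule (Fin (n + 1)) O)) (Y' : Set X')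
          (C : X'.IdealSheafData) (τ : X'' ⟶ X'), Q X' σ' Y' → IsBlowup τ C → Scheme.IsRegular C.subscheme →
          Flat (C.subschemeι ≫ σ' ≫ q) →
          σ' '' (C.support : Set X') ⊆ {x | ¬ IsGenericPoint x (Yc : Set (Proj (homogeneousSubmodule (Fin (n + 1)) O)))} →
          (C.support : Set X') ∩ (σ' ≫ q) ⁻¹' {IsLocalRing.closedPoint O} ⊆ Y' →
          Q X'' (τ ≫ σ') (closure (τ ⁻¹' (Y' \ (C.support : Set X'))))) →
        Q X₁ σ₁ S₁ := ⟨_, fun _ _ _ => Iff.rfl⟩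
  have hChain : ∀ (X' : Scheme.{0}) (σ : X' ⟶ Proj (homogeneousSubmodule (Fin (n + 1)) O)) (S : Set X'),
      Ch X' σ S → Chain (Proj (homogeneousSubmodule (Fin (n + 1)) O))
        (Yc : Set (Proj (homogeneousSubmodule (Fin (n + 1)) O))) X' σ S :=
    fun X' σ S h Q h0 hs => (hCh X' σ S).mp h Q h0
      (fun X₁ X₂ σ' Y' C τ hQ hb hr _ hg' _ => hs X₁ X₂ σ' Y' C τ hQ hb hr hg')
  have hStep : ∀ (X' X'' : Scheme.{0}) (σ' : X' ⟶ Proj (homogeneousSubmodule (Fin (n + 1)) O)) (S' : Set X')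
      (C : X'.IdealSheafData) (τ : X'' ⟶ X'),
      Ch X' σ' S' → IsBlowup τ C → Scheme.IsRegular C.subscheme → Flat (C.subschemeι ≫ σ' ≫ q) →
      σ' '' (C.support : Set X') ⊆ {x | ¬ IsGenericPoint x (Yc : Set (Proj (homogeneousSubmodule (Fin (n + 1)) O)))} →
      (C.support : Set X') ∩ (σ' ≫ q) ⁻¹' {IsLocalRing.closedPoint O} ⊆ S' →
      Ch X'' (τ ≫ σ') (closure (τ ⁻¹' (S' \ (C.support : Set X')))) :=
    fun X' X'' σ' S' C τ h hb hr hfl hg' hE => (hCh _ _ _).mpr fun Q h0 hs =>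
      hs X' X'' σ' S' C τ ((hCh X' σ' S').mp h Q h0 hs) hb hr hfl hg' hE
  have hCh₀ : Ch (Proj (homogeneousSubmodule (Fin (n + 1)) O)) (𝟙 _)
      (Yc : Set (Proj (homogeneousSubmodule (Fin (n + 1)) O))) := (hCh _ _ _).mpr fun Q h0 _ => h0
  haveI hPnoeth : IsLocallyNoetherian (Proj (homogeneousSubmodule (Fin (n + 1)) O)) :=
    LocallyOfFiniteType.isLocallyNoetherian q
  have hPreg : Scheme.IsRegular (Proj (homogeneousSubmodule (Fin (n + 1)) O)) := fun y => (stub_goodAtOfSmooth O _ q hsm y).1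
  haveI hPint : IsIntegral (Proj (homogeneousSubmodule (Fin (n + 1)) O)) :=
    Proj.isIntegral _ (irrelevant_homogeneousSubmodule_ne_bot n O)
  haveI hsrd : SmoothOfRelativeDimension n q := smoothOfRelativeDimension_toSpecZero_specMap n O
  haveI : Nonempty H := inferInstance
  haveI : Nonempty (Proj (homogeneousSubmodule (Fin (n + 1)) O)) := ⟨f (Classical.arbitrary H)⟩
  haveI : Smooth q := hsm
  haveI : IsDominant q := isDominant_of_smooth_of_nonempty q
  have hdom₀ : IsDominant (𝟙 (Proj (homogeneousSubmodule (Fin (n + 1)) O)) ≫ q) := by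
    rw [Category.id_comp]; infer_instance
  have hirrι : IsIrreducible (Set.range ι') := by
    have h := (IrreducibleSpace.isIrreducible_univ H).image ι' ι'.continuous.continuousOn
    rwa [Set.image_univ] at h
  have hT₁cl : IsClosed (Set.range ι') := ι'.isClosedEmbedding.isClosed_range
  haveI hF₁ : IsIntegral (Proj (homogeneousSubmodule (Fin (n + 1)) k)) := isIntegral_proj_homogeneousSubmodule n k
  have hTS : g '' Set.range ι' = (Yc : Set (Proj (homogeneousSubmodule (Fin (n + 1)) O))) := by
    change g '' Set.range ι' = Set.range f
    rw [← Set.range_comp]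
    rfl
  have hK : C.comap g = vanishingIdeal (⟨Z, hZ⟩ : Closeds (Proj (homogeneousSubmodule (Fin (n + 1)) k))) := hKEY φ hφ' hφ
  have hsuppZ : ((vanishingIdeal (⟨Z, hZ⟩ : Closeds (Proj (homogeneousSubmodule (Fin (n + 1)) k)))).support :
      Set (Proj (homogeneousSubmodule (Fin (n + 1)) k))) = Z :=
    Scheme.IdealSheafData.coe_support_vanishingIdeal _
  have hpreC : g ⁻¹' (C.support : Set (Proj (homogeneousSubmodule (Fin (n + 1)) O))) = Z := by
    have h := Scheme.IdealSheafData.support_comap C g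
    rw [hK] at h
    rw [← hsuppZ, h]
    rfl
  have hCsm₁ : Smooth (C.subschemeι ≫ 𝟙 (Proj (homogeneousSubmodule (Fin (n + 1)) O)) ≫ q) := by
    rw [Category.id_comp]; exact hCsm
  haveI : IsRegularRing (CommRingCat.of O) := inferInstanceAs (IsRegularRing O)
  have hCreg : Scheme.IsRegular C.subscheme :=
    Scheme.IsRegular.of_smooth (C.subschemeι ≫ 𝟙 (Proj (homogeneousSubmodule (Fin (n + 1)) O)) ≫ q) (Scheme.isRegular_Spec (.of O))
  have hCflat : Flat (C.subschemeι ≫ 𝟙 (Proj (homogeneousSubmodule (Fin (n + 1)) O)) ≫ q) := inferInstance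
  have hoffpt : ∀ c ∈ (C.support : Set (Proj (homogeneousSubmodule (Fin (n + 1)) O))),
      ¬ IsGenericPoint ((𝟙 (Proj (homogeneousSubmodule (Fin (n + 1)) O)) : _ ⟶ _) c)
        (Yc : Set (Proj (homogeneousSubmodule (Fin (n + 1)) O))) := by
    intro c hc hgen
    change IsGenericPoint c (Yc : Set (Proj (homogeneousSubmodule (Fin (n + 1)) O))) at hgen
    have hce : c = f (genericPoint H) := hgen.eq hgenY
    have hmem : ι' (genericPoint H) ∈ g ⁻¹' (C.support : Set (Proj (homogeneousSubmodule (Fin (n + 1)) O))) := by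
      change g (ι' (genericPoint H)) ∈ (C.support : Set (Proj (homogeneousSubmodule (Fin (n + 1)) O)))
      rw [← Scheme.Hom.comp_apply, ← hce]
      exact hc
    rw [hpreC] at hmem
    apply hZnsub
    change Set.range ι' ⊆ Z
    rw [← hgenι]
    exact closure_minimal (Set.singleton_subset_iff.mpr hmem) hZ
  have hoff : (𝟙 (Proj (homogeneousSubmodule (Fin (n + 1)) O)) : _ ⟶ _) '' (C.support : Set (Proj (homogeneousSubmodule (Fin (n + 1)) O))) ⊆
      {x | ¬ IsGenericPoint x (Yc : Set (Proj (homogeneousSubmodule (Fin (n + 1)) O)))} := by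
    rintro _ ⟨c, hc, rfl⟩
    exact hoffpt c hc
  have hDT : ((vanishingIdeal (⟨Z, hZ⟩ : Closeds (Proj (homogeneousSubmodule (Fin (n + 1)) k)))).support :
      Set (Proj (homogeneousSubmodule (Fin (n + 1)) k))) ⊆ Set.range ι' := by
    rw [hsuppZ]; exact hZsub
  have hTD : ¬ (Set.range ι' ⊆ ((vanishingIdeal (⟨Z, hZ⟩ : Closeds (Proj (homogeneousSubmodule (Fin (n + 1)) k)))).support :
      Set (Proj (homogeneousSubmodule (Fin (n + 1)) k)))) := by
    rw [hsuppZ]; exact hZnsub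
  obtain ⟨X₁, τ₁, hτ₁⟩ := exists_isBlowup (Proj (homogeneousSubmodule (Fin (n + 1)) O)) C
  obtain ⟨hint₁, hnoeth₁, hreg₁, hdom₁, hF₂, hirr₂, j₂, t₂, hsq₂, hcomm, hCh₁⟩ :=
    modelStep_chain O k π hπ _ q (Yc : Set (Proj (homogeneousSubmodule (Fin (n + 1)) O))) hYirr Yc.isClosed Ch hChain hStep
      _ (𝟙 _) (Yc : Set (Proj (homogeneousSubmodule (Fin (n + 1)) O))) hCh₀ hPreg hdom₀ _ g _ hsq₀ (Set.range ι') hTS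
      C (vanishingIdeal (⟨Z, hZ⟩ : Closeds (Proj (homogeneousSubmodule (Fin (n + 1)) k)))) hK hCreg hCflat hoff hDT hTD
      X₁ τ₁ hτ₁ F₂ υ hυ
  rw [hsuppZ] at hirr₂ hCh₁
  have hE : (C.comap τ₁).comap j₂ =
      (vanishingIdeal (⟨Z, hZ⟩ : Closeds (Proj (homogeneousSubmodule (Fin (n + 1)) k)))).comap υ := by
    rw [← Scheme.IdealSheafData.comap_comp, hcomm, Scheme.IdealSheafData.comap_comp, hK]
  obtain ⟨X₉, σ₉, S₉, j₉, t₉, hCh₉, -, -, -, -, hsq₉, hsets₉, hT'cl, -, -⟩ :=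
    hsub O π hπ _ q (Yc : Set (Proj (homogeneousSubmodule (Fin (n + 1)) O))) Ch hStep hChain hYs hYirr Yc.isClosed
      hPint hPnoeth hPreg hprop hsrd _ (𝟙 _) (Yc : Set (Proj (homogeneousSubmodule (Fin (n + 1)) O))) hCh₀ hPint hPnoeth hPreg hdom₀
      _ hF₁ g _ hsq₀ (Set.range ι') hT₁cl hirrι hTS Z hZ hZsub hZnsub hZinf C hCsm₁ hCreg hCflat hK hoffpt
      X₁ τ₁ hτ₁ hint₁ hnoeth₁ hreg₁ hdom₁ F₂ hF₂ υ hυ j₂ t₂ hsq₂ hcomm hE hirr₂ hCh₁ F' γ' T' E' K' htower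
  haveI hj₉ci : IsClosedImmersion j₉ := MorphismProperty.IsStableUnderBaseChange.of_isPullback hsq₉.flip inferInstance
  have hT'img : IsClosed (j₉ '' T') := hj₉ci.isClosedEmbedding.isClosedMap _ hT'cl
  have hZ1 : (⟨closure T', isClosed_closure⟩ : Closeds F') = ⟨T', hT'cl⟩ := Closeds.ext hT'cl.closure_eq
  have hZ2 : (⟨closure S₉, isClosed_closure⟩ : Closeds X₉) = ⟨j₉ '' T', hT'img⟩ :=
    Closeds.ext (by change closure S₉ = j₉ '' T'; rw [← hsets₉]; exact hT'img.closure_eq)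
  change Scheme.IsRegular (vanishingIdeal (⟨closure T', isClosed_closure⟩ : Closeds F')).subscheme at hregD
  rw [hZ1] at hregD
  refine ⟨X₉, σ₉, S₉, (hCh X₉ σ₉ S₉).mp hCh₉, ?_⟩
  rw [hZ2]
  exact (isRegular_subscheme_vanishingIdeal_image_iff j₉ ⟨T', hT'cl⟩ hT'img).mpr hregD

end Summit.ResolutionOfSingularities.ResolutionOfSingularities.Cruxes.EquisingularLiftNat.Sections

end
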